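import Summits.Parity.GeneralizedHardyLittlewood.Theorems.GreenTaoLevelTwoMNTwoPolarization

/-!
# Route `GreenTaoLevelTwo`, crux `MNTwo` (stmt-Parity-21276), line `birth`, stub `stub_mnVertical`:
# explicit quartic structure of a locally quadratic phase along `(d+sl)(w+tm)` (GT 2008b Lemma 21)

Tool for block V4 (= AIF §10, Lemma 24 "Type II sum implies major arc") of the `stub_mnVertical`
census (B. Green, T. Tao, *Quadratic uniformity of the Möbius function*, Ann. Inst. Fourier 58
(2008) = arXiv:math/0606087, §9 Lemma 21 "Explicit quartic structure": for `φ` locally quadratic on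
`B_g(n₀, 100ρ₀)`, `P(l,m) = (d+sl)(w+tm)`, `LM‖st‖_g ≤ ρ₀`, `|lᵢ| ≤ L`, `|mᵢ| ≤ M` and the values
`P(l₀+i₁l₁+i₂l₂, m₀+j₁m₁+j₂m₂)` in `B_g(n₀,ρ₀)`, the alternating sum
`∑ (−1)^{i₁+i₂+j₁+j₂} φ(P(l₀+i₁l₁+i₂l₂, m₀+j₁m₁+j₂m₂)) = 2l₁l₂m₁m₂ φ''(st,st)`).

ABSTRACT, def-free form in the vocabulary of `…MNTwoLocalQuadratic` / `…MNTwoPolarization`: a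
symmetric subadditive gauge `ν : ℤ → ℝ` replaces `‖·‖_g`, the phase is valued in any additive
commutative group, "locally quadratic on `B(n₀,R)`" is the eight-point hypothesis `hφ`, and
`φ''(a,b) = φ(n₀+a+b) − φ(n₀+a) − φ(n₀+b) + φ(n₀)`.  Of the paper's sixteen membership constraints
only the five actually used by its proof (`(dweeb)`) are assumed.

* `gauge_sub_ball` — `ν(x − y) < 2ρ` for `x, y ∈ B(n₀, ρ)`;
* `second_deriv_add_right`, `second_deriv_add2_add2`, `second_deriv_add3_add3` — bilinear
  expansions of `φ''`;
* `quartic_structure` — **Lemma 21**.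

References: [GreenTao2008QuadraticMobius] arXiv:math/0606087 §9, Lemma 21 and eqs. (taylor),
(bilinear), (dweeb).
-/

namespace Summit.Parity.GeneralizedHardyLittlewood.GreenTaoLevelTwoMNTwoQuarticStructure

open Summit.Parity.GeneralizedHardyLittlewood.GreenTaoLevelTwoMNTwoLocalQuadratic
  (gauge_nsmul_le second_diff_eq_second_diff_center second_deriv_add_left second_deriv_comm
    second_deriv_nsmul_left)
open Summit.Parity.GeneralizedHardyLittlewood.GreenTaoLevelTwoMNTwoPolarization
  (gauge_zsmul_le second_deriv_zsmul_left)

variable {G : Type*} [AddCommGroup G]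

/-- Two points of the gauge ball `B(n₀, ρ)` differ by an element of `B(0, 2ρ)` (symmetric,
subadditive gauge). [folklore] -/
theorem gauge_sub_ball (ν : ℤ → ℝ) (hνneg : ∀ x, ν (-x) = ν x)
    (hνadd : ∀ x y, ν (x + y) ≤ ν x + ν y) {x y n₀ : ℤ} {ρ : ℝ} (hx : ν (x - n₀) < ρ)
    (hy : ν (y - n₀) < ρ) : ν (x - y) < 2 * ρ := by
  have e : x - y = (x - n₀) + -(y - n₀) := by ring
  rw [e]
  calc ν ((x - n₀) + -(y - n₀)) ≤ ν (x - n₀) + ν (-(y - n₀)) := hνadd _ _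
    _ = ν (x - n₀) + ν (y - n₀) := by rw [hνneg]
    _ < 2 * ρ := by linarith

variable (ν : ℤ → ℝ) (hν0 : ν 0 = 0) (hνnn : ∀ x, 0 ≤ ν x) (hνneg : ∀ x, ν (-x) = ν x)
  (hνadd : ∀ x y, ν (x + y) ≤ ν x + ν y) (φ : ℤ → G) {n₀ : ℤ} {R : ℝ}
  (hφ : ∀ n a b c : ℤ, ν (n - n₀) < R → ν (n + a - n₀) < R → ν (n + b - n₀) < R →
    ν (n + c - n₀) < R → ν (n + a + b - n₀) < R → ν (n + a + c - n₀) < R →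
    ν (n + b + c - n₀) < R → ν (n + a + b + c - n₀) < R →
    φ (n + a + b + c) - φ (n + a + b) - φ (n + a + c) - φ (n + b + c)
      + φ (n + a) + φ (n + b) + φ (n + c) - φ n = 0)
include hν0 hνnn hνadd hφ

/-- **(bilinear), additivity in the second slot**: `φ''(a, b + b') = φ''(a,b) + φ''(a,b')` when
`ν a, ν b, ν b' < r` and `3r ≤ R`. [cite: GreenTao2008QuadraticMobius, §9 eq. (bilinear)] -/
theorem second_deriv_add_right {a b b' : ℤ} {r : ℝ} (ha : ν a < r) (hb : ν b < r)
    (hb' : ν b' < r) (hR : 3 * r ≤ R) :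
    φ (n₀ + a + (b + b')) - φ (n₀ + a) - φ (n₀ + (b + b')) + φ n₀ =
      (φ (n₀ + a + b) - φ (n₀ + a) - φ (n₀ + b) + φ n₀) +
        (φ (n₀ + a + b') - φ (n₀ + a) - φ (n₀ + b') + φ n₀) := by
  rw [second_deriv_comm φ n₀ a (b + b'), second_deriv_comm φ n₀ a b,
    second_deriv_comm φ n₀ a b']
  exact second_deriv_add_left ν hν0 hνnn hνadd φ hφ hb hb' ha hR

/-- **`2 × 2` bilinear expansion**: `φ''(x₁+x₂, y₁+y₂) = ∑ᵢⱼ φ''(xᵢ, yⱼ)` when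
`ν xᵢ, ν yⱼ, ν(y₁+y₂) < r` and `3r ≤ R`.
[cite: GreenTao2008QuadraticMobius, §9 eq. (bilinear)] -/
theorem second_deriv_add2_add2 {x₁ x₂ y₁ y₂ : ℤ} {r : ℝ} (hx₁ : ν x₁ < r) (hx₂ : ν x₂ < r)
    (hy₁ : ν y₁ < r) (hy₂ : ν y₂ < r) (hy : ν (y₁ + y₂) < r) (hR : 3 * r ≤ R) :
    φ (n₀ + (x₁ + x₂) + (y₁ + y₂)) - φ (n₀ + (x₁ + x₂)) - φ (n₀ + (y₁ + y₂)) + φ n₀ =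
      (φ (n₀ + x₁ + y₁) - φ (n₀ + x₁) - φ (n₀ + y₁) + φ n₀) +
      (φ (n₀ + x₁ + y₂) - φ (n₀ + x₁) - φ (n₀ + y₂) + φ n₀) +
      (φ (n₀ + x₂ + y₁) - φ (n₀ + x₂) - φ (n₀ + y₁) + φ n₀) +
      (φ (n₀ + x₂ + y₂) - φ (n₀ + x₂) - φ (n₀ + y₂) + φ n₀) := by
  rw [second_deriv_add_left ν hν0 hνnn hνadd φ hφ hx₁ hx₂ hy hR,
    second_deriv_add_right ν hν0 hνnn hνadd φ hφ hx₁ hy₁ hy₂ hR,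
    second_deriv_add_right ν hν0 hνnn hνadd φ hφ hx₂ hy₁ hy₂ hR]
  abel

/-- **`3 × 3` bilinear expansion**: `φ''(x₁+x₂+x₃, y₁+y₂+y₃) = ∑ᵢⱼ φ''(xᵢ, yⱼ)` when all of
`ν xᵢ, ν yⱼ, ν(x₁+x₂), ν(y₁+y₂), ν(y₁+y₂+y₃)` are `< r` and `3r ≤ R`.
[cite: GreenTao2008QuadraticMobius, §9 eq. (bilinear)] -/
theorem second_deriv_add3_add3 {x₁ x₂ x₃ y₁ y₂ y₃ : ℤ} {r : ℝ} (hx₁ : ν x₁ < r) (hx₂ : ν x₂ < r)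
    (hx₃ : ν x₃ < r) (hx₁₂ : ν (x₁ + x₂) < r) (hy₁ : ν y₁ < r) (hy₂ : ν y₂ < r) (hy₃ : ν y₃ < r)
    (hy₁₂ : ν (y₁ + y₂) < r) (hy : ν (y₁ + y₂ + y₃) < r) (hR : 3 * r ≤ R) :
    φ (n₀ + (x₁ + x₂ + x₃) + (y₁ + y₂ + y₃)) - φ (n₀ + (x₁ + x₂ + x₃)) -
        φ (n₀ + (y₁ + y₂ + y₃)) + φ n₀ =
      (φ (n₀ + x₁ + y₁) - φ (n₀ + x₁) - φ (n₀ + y₁) + φ n₀) +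
      (φ (n₀ + x₁ + y₂) - φ (n₀ + x₁) - φ (n₀ + y₂) + φ n₀) +
      (φ (n₀ + x₁ + y₃) - φ (n₀ + x₁) - φ (n₀ + y₃) + φ n₀) +
      (φ (n₀ + x₂ + y₁) - φ (n₀ + x₂) - φ (n₀ + y₁) + φ n₀) +
      (φ (n₀ + x₂ + y₂) - φ (n₀ + x₂) - φ (n₀ + y₂) + φ n₀) +
      (φ (n₀ + x₂ + y₃) - φ (n₀ + x₂) - φ (n₀ + y₃) + φ n₀) +
      (φ (n₀ + x₃ + y₁) - φ (n₀ + x₃) - φ (n₀ + y₁) + φ n₀) +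
      (φ (n₀ + x₃ + y₂) - φ (n₀ + x₃) - φ (n₀ + y₂) + φ n₀) +
      (φ (n₀ + x₃ + y₃) - φ (n₀ + x₃) - φ (n₀ + y₃) + φ n₀) := by
  -- expand in the first slot: `(x₁ + x₂) + x₃`, then `x₁ + x₂`
  have s1 := second_deriv_add_left ν hν0 hνnn hνadd φ hφ hx₁₂ hx₃ hy hR
  have s2 := second_deriv_add_left ν hν0 hνnn hνadd φ hφ hx₁ hx₂ hy hR
  -- expand each `φ''(xᵢ, (y₁ + y₂) + y₃)` in the second slot
  have t : ∀ {a : ℤ}, ν a < r →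
      φ (n₀ + a + (y₁ + y₂ + y₃)) - φ (n₀ + a) - φ (n₀ + (y₁ + y₂ + y₃)) + φ n₀ =
        (φ (n₀ + a + (y₁ + y₂)) - φ (n₀ + a) - φ (n₀ + (y₁ + y₂)) + φ n₀) +
          (φ (n₀ + a + y₃) - φ (n₀ + a) - φ (n₀ + y₃) + φ n₀) :=
    fun ha => second_deriv_add_right ν hν0 hνnn hνadd φ hφ ha hy₁₂ hy₃ hR
  have u : ∀ {a : ℤ}, ν a < r →
      φ (n₀ + a + (y₁ + y₂)) - φ (n₀ + a) - φ (n₀ + (y₁ + y₂)) + φ n₀ =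
        (φ (n₀ + a + y₁) - φ (n₀ + a) - φ (n₀ + y₁) + φ n₀) +
          (φ (n₀ + a + y₂) - φ (n₀ + a) - φ (n₀ + y₂) + φ n₀) :=
    fun ha => second_deriv_add_right ν hν0 hνnn hνadd φ hφ ha hy₁ hy₂ hR
  rw [s1, s2, t hx₁, t hx₂, t hx₃, u hx₁, u hx₂, u hx₃]
  abel

include hνneg

/-- **Explicit quartic structure (GT 2008b Lemma 21).**  Let `φ` be locally quadratic on the gauge
ball `B(n₀, R)` (symmetric subadditive gauge `ν`), let `d, w, s, t ∈ ℤ`, `1 ≤ L, M`, with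
`L·M·ν(st) ≤ ρ` and `13ρ ≤ R`, and let `l₀, l₁, l₂, m₀, m₁, m₂ ∈ ℤ` with `|l₁|, |l₂| ≤ L`,
`|m₁|, |m₂| ≤ M`.  Writing `P(l,m) = (d + sl)(w + tm)`, assume the five values `P(l₀,m₀)`,
`P(l₀+l₁,m₀)`, `P(l₀+l₂,m₀)`, `P(l₀,m₀+m₁)`, `P(l₀,m₀+m₂)` lie in `B(n₀, ρ)` (the paper assumes all
sixteen `P(l₀+i₁l₁+i₂l₂, m₀+j₁m₁+j₂m₂)`; its proof uses only these five).  Then the alternating sum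
`∑_{i₁,i₂,j₁,j₂ ∈ {0,1}} (−1)^{i₁+i₂+j₁+j₂} φ(P(l₀+i₁l₁+i₂l₂, m₀+j₁m₁+j₂m₂))` equals
`(2 l₁ l₂ m₁ m₂) • φ''(st, st)`. [cite: GreenTao2008QuadraticMobius, Lemma 21] -/
theorem quartic_structure {ρ : ℝ} (hR : 13 * ρ ≤ R) (d w s t : ℤ) {L M : ℕ} (hL : 1 ≤ L)
    (hM : 1 ≤ M) (hst : (L : ℝ) * M * ν (s * t) ≤ ρ) (l₀ l₁ l₂ m₀ m₁ m₂ : ℤ)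
    (hl₁ : |l₁| ≤ L) (hl₂ : |l₂| ≤ L) (hm₁ : |m₁| ≤ M) (hm₂ : |m₂| ≤ M)
    (h00 : ν ((d + s * l₀) * (w + t * m₀) - n₀) < ρ)
    (h10 : ν ((d + s * (l₀ + l₁)) * (w + t * m₀) - n₀) < ρ)
    (h20 : ν ((d + s * (l₀ + l₂)) * (w + t * m₀) - n₀) < ρ)
    (h01 : ν ((d + s * l₀) * (w + t * (m₀ + m₁)) - n₀) < ρ)
    (h02 : ν ((d + s * l₀) * (w + t * (m₀ + m₂)) - n₀) < ρ) :
    (φ ((d + s * l₀) * (w + t * m₀)) - φ ((d + s * l₀) * (w + t * (m₀ + m₁)))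
      - φ ((d + s * l₀) * (w + t * (m₀ + m₂))) + φ ((d + s * l₀) * (w + t * (m₀ + m₁ + m₂))))
    - (φ ((d + s * (l₀ + l₁)) * (w + t * m₀)) - φ ((d + s * (l₀ + l₁)) * (w + t * (m₀ + m₁)))
      - φ ((d + s * (l₀ + l₁)) * (w + t * (m₀ + m₂)))
      + φ ((d + s * (l₀ + l₁)) * (w + t * (m₀ + m₁ + m₂))))
    - (φ ((d + s * (l₀ + l₂)) * (w + t * m₀)) - φ ((d + s * (l₀ + l₂)) * (w + t * (m₀ + m₁)))
      - φ ((d + s * (l₀ + l₂)) * (w + t * (m₀ + m₂)))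
      + φ ((d + s * (l₀ + l₂)) * (w + t * (m₀ + m₁ + m₂))))
    + (φ ((d + s * (l₀ + l₁ + l₂)) * (w + t * m₀))
      - φ ((d + s * (l₀ + l₁ + l₂)) * (w + t * (m₀ + m₁)))
      - φ ((d + s * (l₀ + l₁ + l₂)) * (w + t * (m₀ + m₂)))
      + φ ((d + s * (l₀ + l₁ + l₂)) * (w + t * (m₀ + m₁ + m₂)))) =
    (2 * l₁ * l₂ * m₁ * m₂) •
      (φ (n₀ + s * t + s * t) - φ (n₀ + s * t) - φ (n₀ + s * t) + φ n₀) := by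
  -- positivity of `ρ`
  have hρ : 0 < ρ := lt_of_le_of_lt (hνnn _) h00
  -- shifted variables (the reduction to `l₀ = m₀ = 0`)
  obtain ⟨d', hd'⟩ : ∃ d' : ℤ, d' = d + s * l₀ := ⟨_, rfl⟩
  obtain ⟨w', hw'⟩ : ∃ w' : ℤ, w' = w + t * m₀ := ⟨_, rfl⟩
  -- the atoms: `a₁ = d't m₁`, `b₁ = st l₁m₁`, `c₁ = st l₂m₁`, `a₂ = d't m₂`, `b₂ = st l₁m₂`,
  -- `c₂ = st l₂m₂`, and the base-point increments `p₁ = sw'l₁`, `p₂ = sw'l₂`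
  -- gauge bounds on `st lᵢ mⱼ`
  have habs : ∀ (l m : ℤ), |l| ≤ L → |m| ≤ M → |((l * m : ℤ) : ℝ)| ≤ (L : ℝ) * M := by
    intro l m hl hm
    have : |l * m| ≤ (L : ℤ) * M := by
      rw [abs_mul]; exact mul_le_mul hl hm (abs_nonneg _) (by positivity)
    rw [← Int.cast_abs]; exact_mod_cast this
  have hLM : ∀ (l m : ℤ), |l| ≤ L → |m| ≤ M → ν (s * t * l * m) ≤ ρ := by
    intro l m hl hm
    have h1 := gauge_zsmul_le ν hν0 hνneg hνadd (s * t) (l * m)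
    rw [show l * m * (s * t) = s * t * l * m by ring] at h1
    have h4 := mul_le_mul_of_nonneg_right (habs l m hl hm) (hνnn (s * t))
    linarith
  have hst1 : ν (s * t) ≤ ρ := by
    have h1 : (1 : ℝ) ≤ (L : ℝ) * M := by
      have : (1 : ℝ) ≤ L := by exact_mod_cast hL
      have : (1 : ℝ) ≤ M := by exact_mod_cast hM
      nlinarith
    have h2 := mul_le_mul_of_nonneg_right h1 (hνnn (s * t))
    linarith
  -- membership facts (dweeb)
  have e00 : (d + s * l₀) * (w + t * m₀) = d' * w' := by rw [hd', hw']
  have hn00 : ν (d' * w' - n₀) < ρ := by rw [← e00]; exact h00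
  have hp₁ : ν (s * w' * l₁) < 2 * ρ := by
    have := gauge_sub_ball ν hνneg hνadd h10 h00
    rw [show (d + s * (l₀ + l₁)) * (w + t * m₀) - (d + s * l₀) * (w + t * m₀) = s * w' * l₁ by
      rw [hw']; ring] at this
    exact this
  have hp₂ : ν (s * w' * l₂) < 2 * ρ := by
    have := gauge_sub_ball ν hνneg hνadd h20 h00
    rw [show (d + s * (l₀ + l₂)) * (w + t * m₀) - (d + s * l₀) * (w + t * m₀) = s * w' * l₂ by
      rw [hw']; ring] at this
    exact this
  have ha₁ : ν (d' * t * m₁) < 2 * ρ := by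
    have := gauge_sub_ball ν hνneg hνadd h01 h00
    rw [show (d + s * l₀) * (w + t * (m₀ + m₁)) - (d + s * l₀) * (w + t * m₀) = d' * t * m₁ by
      rw [hd']; ring] at this
    exact this
  have ha₂ : ν (d' * t * m₂) < 2 * ρ := by
    have := gauge_sub_ball ν hνneg hνadd h02 h00
    rw [show (d + s * l₀) * (w + t * (m₀ + m₂)) - (d + s * l₀) * (w + t * m₀) = d' * t * m₂ by
      rw [hd']; ring] at this
    exact this
  have hb₁ : ν (s * t * l₁ * m₁) ≤ ρ := hLM l₁ m₁ hl₁ hm₁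
  have hc₁ : ν (s * t * l₂ * m₁) ≤ ρ := hLM l₂ m₁ hl₂ hm₁
  have hb₂ : ν (s * t * l₁ * m₂) ≤ ρ := hLM l₁ m₂ hl₁ hm₂
  have hc₂ : ν (s * t * l₂ * m₂) ≤ ρ := hLM l₂ m₂ hl₂ hm₂
  -- all atoms and the partial sums used lie in `B(0, 4ρ)`; `3 · 4ρ ≤ R`
  have hR4 : 3 * (4 * ρ) ≤ R := by linarith
  have at_a₁ : ν (d' * t * m₁) < 4 * ρ := by linarith
  have at_a₂ : ν (d' * t * m₂) < 4 * ρ := by linarith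
  have at_b₁ : ν (s * t * l₁ * m₁) < 4 * ρ := by linarith
  have at_c₁ : ν (s * t * l₂ * m₁) < 4 * ρ := by linarith
  have at_b₂ : ν (s * t * l₁ * m₂) < 4 * ρ := by linarith
  have at_c₂ : ν (s * t * l₂ * m₂) < 4 * ρ := by linarith
  have at_ab₁ : ν (d' * t * m₁ + s * t * l₁ * m₁) < 4 * ρ := by
    linarith [hνadd (d' * t * m₁) (s * t * l₁ * m₁)]
  have at_ac₁ : ν (d' * t * m₁ + s * t * l₂ * m₁) < 4 * ρ := by
    linarith [hνadd (d' * t * m₁) (s * t * l₂ * m₁)]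
  have at_abc₁ : ν (d' * t * m₁ + s * t * l₁ * m₁ + s * t * l₂ * m₁) < 4 * ρ := by
    linarith [hνadd (d' * t * m₁ + s * t * l₁ * m₁) (s * t * l₂ * m₁),
      hνadd (d' * t * m₁) (s * t * l₁ * m₁)]
  have at_ab₂ : ν (d' * t * m₂ + s * t * l₁ * m₂) < 4 * ρ := by
    linarith [hνadd (d' * t * m₂) (s * t * l₁ * m₂)]
  have at_ac₂ : ν (d' * t * m₂ + s * t * l₂ * m₂) < 4 * ρ := by
    linarith [hνadd (d' * t * m₂) (s * t * l₂ * m₂)]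
  have at_abc₂ : ν (d' * t * m₂ + s * t * l₁ * m₂ + s * t * l₂ * m₂) < 4 * ρ := by
    linarith [hνadd (d' * t * m₂ + s * t * l₁ * m₂) (s * t * l₂ * m₂),
      hνadd (d' * t * m₂) (s * t * l₁ * m₂)]
  -- base points lie in `B(n₀, 5ρ)`; `5ρ + 2·4ρ ≤ R`
  have hR13 : 5 * ρ + 2 * (4 * ρ) ≤ R := by linarith
  have bp00 : ν (d' * w' - n₀) < 5 * ρ := by linarith
  have bp10 : ν (d' * w' + s * w' * l₁ - n₀) < 5 * ρ := by
    have := hνadd (d' * w' - n₀) (s * w' * l₁)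
    rw [show d' * w' - n₀ + s * w' * l₁ = d' * w' + s * w' * l₁ - n₀ by ring] at this
    linarith
  have bp20 : ν (d' * w' + s * w' * l₂ - n₀) < 5 * ρ := by
    have := hνadd (d' * w' - n₀) (s * w' * l₂)
    rw [show d' * w' - n₀ + s * w' * l₂ = d' * w' + s * w' * l₂ - n₀ by ring] at this
    linarith
  have bp12 : ν (d' * w' + s * w' * l₁ + s * w' * l₂ - n₀) < 5 * ρ := by
    have h1 := hνadd (d' * w' - n₀) (s * w' * l₁)
    have h2 := hνadd (d' * w' - n₀ + s * w' * l₁) (s * w' * l₂)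
    rw [show d' * w' - n₀ + s * w' * l₁ + s * w' * l₂ = d' * w' + s * w' * l₁ + s * w' * l₂ - n₀
      by ring] at h2
    linarith
  -- the four second differences, by (taylor)
  have T00 : φ ((d + s * l₀) * (w + t * m₀)) - φ ((d + s * l₀) * (w + t * (m₀ + m₁)))
      - φ ((d + s * l₀) * (w + t * (m₀ + m₂))) + φ ((d + s * l₀) * (w + t * (m₀ + m₁ + m₂))) =
      φ (n₀ + d' * t * m₁ + d' * t * m₂) - φ (n₀ + d' * t * m₁) - φ (n₀ + d' * t * m₂) + φ n₀ := by
    have key := second_diff_eq_second_diff_center ν hν0 hνnn hνadd φ hφ bp00 at_a₁ at_a₂ hR13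
    have e1 : (d + s * l₀) * (w + t * (m₀ + m₁ + m₂)) = d' * w' + d' * t * m₁ + d' * t * m₂ := by
      rw [hd', hw']; ring
    have e2 : (d + s * l₀) * (w + t * (m₀ + m₁)) = d' * w' + d' * t * m₁ := by rw [hd', hw']; ring
    have e3 : (d + s * l₀) * (w + t * (m₀ + m₂)) = d' * w' + d' * t * m₂ := by rw [hd', hw']; ring
    rw [e00, e1, e2, e3, ← key]; abel
  have T10 : φ ((d + s * (l₀ + l₁)) * (w + t * m₀)) - φ ((d + s * (l₀ + l₁)) * (w + t * (m₀ + m₁)))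
      - φ ((d + s * (l₀ + l₁)) * (w + t * (m₀ + m₂)))
      + φ ((d + s * (l₀ + l₁)) * (w + t * (m₀ + m₁ + m₂))) =
      φ (n₀ + (d' * t * m₁ + s * t * l₁ * m₁) + (d' * t * m₂ + s * t * l₁ * m₂))
        - φ (n₀ + (d' * t * m₁ + s * t * l₁ * m₁)) - φ (n₀ + (d' * t * m₂ + s * t * l₁ * m₂))
        + φ n₀ := by
    have key := second_diff_eq_second_diff_center ν hν0 hνnn hνadd φ hφ bp10 at_ab₁ at_ab₂ hR13
    have e0 : (d + s * (l₀ + l₁)) * (w + t * m₀) = d' * w' + s * w' * l₁ := by rw [hd', hw']; ring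
    have e1 : (d + s * (l₀ + l₁)) * (w + t * (m₀ + m₁ + m₂)) = d' * w' + s * w' * l₁ +
        (d' * t * m₁ + s * t * l₁ * m₁) + (d' * t * m₂ + s * t * l₁ * m₂) := by rw [hd', hw']; ring
    have e2 : (d + s * (l₀ + l₁)) * (w + t * (m₀ + m₁)) = d' * w' + s * w' * l₁ +
        (d' * t * m₁ + s * t * l₁ * m₁) := by rw [hd', hw']; ring
    have e3 : (d + s * (l₀ + l₁)) * (w + t * (m₀ + m₂)) = d' * w' + s * w' * l₁ +
        (d' * t * m₂ + s * t * l₁ * m₂) := by rw [hd', hw']; ring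
    rw [e0, e1, e2, e3, ← key]; abel
  have T20 : φ ((d + s * (l₀ + l₂)) * (w + t * m₀)) - φ ((d + s * (l₀ + l₂)) * (w + t * (m₀ + m₁)))
      - φ ((d + s * (l₀ + l₂)) * (w + t * (m₀ + m₂)))
      + φ ((d + s * (l₀ + l₂)) * (w + t * (m₀ + m₁ + m₂))) =
      φ (n₀ + (d' * t * m₁ + s * t * l₂ * m₁) + (d' * t * m₂ + s * t * l₂ * m₂))
        - φ (n₀ + (d' * t * m₁ + s * t * l₂ * m₁)) - φ (n₀ + (d' * t * m₂ + s * t * l₂ * m₂))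
        + φ n₀ := by
    have key := second_diff_eq_second_diff_center ν hν0 hνnn hνadd φ hφ bp20 at_ac₁ at_ac₂ hR13
    have e0 : (d + s * (l₀ + l₂)) * (w + t * m₀) = d' * w' + s * w' * l₂ := by rw [hd', hw']; ring
    have e1 : (d + s * (l₀ + l₂)) * (w + t * (m₀ + m₁ + m₂)) = d' * w' + s * w' * l₂ +
        (d' * t * m₁ + s * t * l₂ * m₁) + (d' * t * m₂ + s * t * l₂ * m₂) := by rw [hd', hw']; ring
    have e2 : (d + s * (l₀ + l₂)) * (w + t * (m₀ + m₁)) = d' * w' + s * w' * l₂ +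
        (d' * t * m₁ + s * t * l₂ * m₁) := by rw [hd', hw']; ring
    have e3 : (d + s * (l₀ + l₂)) * (w + t * (m₀ + m₂)) = d' * w' + s * w' * l₂ +
        (d' * t * m₂ + s * t * l₂ * m₂) := by rw [hd', hw']; ring
    rw [e0, e1, e2, e3, ← key]; abel
  have T12 : φ ((d + s * (l₀ + l₁ + l₂)) * (w + t * m₀))
      - φ ((d + s * (l₀ + l₁ + l₂)) * (w + t * (m₀ + m₁)))
      - φ ((d + s * (l₀ + l₁ + l₂)) * (w + t * (m₀ + m₂)))
      + φ ((d + s * (l₀ + l₁ + l₂)) * (w + t * (m₀ + m₁ + m₂))) =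
      φ (n₀ + (d' * t * m₁ + s * t * l₁ * m₁ + s * t * l₂ * m₁)
          + (d' * t * m₂ + s * t * l₁ * m₂ + s * t * l₂ * m₂))
        - φ (n₀ + (d' * t * m₁ + s * t * l₁ * m₁ + s * t * l₂ * m₁))
        - φ (n₀ + (d' * t * m₂ + s * t * l₁ * m₂ + s * t * l₂ * m₂)) + φ n₀ := by
    have key := second_diff_eq_second_diff_center ν hν0 hνnn hνadd φ hφ bp12 at_abc₁ at_abc₂ hR13
    have e0 : (d + s * (l₀ + l₁ + l₂)) * (w + t * m₀) = d' * w' + s * w' * l₁ + s * w' * l₂ := by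
      rw [hd', hw']; ring
    have e1 : (d + s * (l₀ + l₁ + l₂)) * (w + t * (m₀ + m₁ + m₂)) =
        d' * w' + s * w' * l₁ + s * w' * l₂ +
        (d' * t * m₁ + s * t * l₁ * m₁ + s * t * l₂ * m₁)
          + (d' * t * m₂ + s * t * l₁ * m₂ + s * t * l₂ * m₂) := by rw [hd', hw']; ring
    have e2 : (d + s * (l₀ + l₁ + l₂)) * (w + t * (m₀ + m₁)) = d' * w' + s * w' * l₁ + s * w' * l₂ +
        (d' * t * m₁ + s * t * l₁ * m₁ + s * t * l₂ * m₁) := by rw [hd', hw']; ring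
    have e3 : (d + s * (l₀ + l₁ + l₂)) * (w + t * (m₀ + m₂)) = d' * w' + s * w' * l₁ + s * w' * l₂ +
        (d' * t * m₂ + s * t * l₁ * m₂ + s * t * l₂ * m₂) := by rw [hd', hw']; ring
    rw [e0, e1, e2, e3, ← key]; abel
  -- bilinear expansions of the three non-trivial second differences
  have X10 := second_deriv_add2_add2 ν hν0 hνnn hνadd φ hφ at_a₁ at_b₁ at_a₂ at_b₂ at_ab₂ hR4
  have X20 := second_deriv_add2_add2 ν hν0 hνnn hνadd φ hφ at_a₁ at_c₁ at_a₂ at_c₂ at_ac₂ hR4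
  have X12 := second_deriv_add3_add3 ν hν0 hνnn hνadd φ hφ at_a₁ at_b₁ at_c₁ at_ab₁
    at_a₂ at_b₂ at_c₂ at_ab₂ at_abc₂ hR4
  -- the two surviving cross terms are integer multiples of `φ''(st, st)`
  have hst4 : ν (s * t) < 4 * ρ := by linarith
  have cross : ∀ (l m l' m' : ℤ), |l| ≤ L → |m| ≤ M → |l'| ≤ L → |m'| ≤ M →
      φ (n₀ + s * t * l * m + s * t * l' * m') - φ (n₀ + s * t * l * m) - φ (n₀ + s * t * l' * m')
        + φ n₀ = (l * m * (l' * m')) •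
          (φ (n₀ + s * t + s * t) - φ (n₀ + s * t) - φ (n₀ + s * t) + φ n₀) := by
    intro l m l' m' hl hm hl' hm'
    have hk : ∀ (a b : ℤ), |a| ≤ L → |b| ≤ M → |((a * b : ℤ) : ℝ)| * ν (s * t) < 4 * ρ := by
      intro a b ha hb
      have h4 := mul_le_mul_of_nonneg_right (habs a b ha hb) (hνnn (s * t))
      linarith
    have hlm' : ν (s * t * l' * m') < 4 * ρ := by linarith [hLM l' m' hl' hm']
    -- first slot
    have s1 := second_deriv_zsmul_left ν hν0 hνnn hνneg hνadd φ hφ (l * m) (hk l m hl hm) hst4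
      hlm' hR4
    rw [show (l * m : ℤ) * (s * t) = s * t * l * m by ring] at s1
    -- second slot
    have s2 := second_deriv_zsmul_left ν hν0 hνnn hνneg hνadd φ hφ (l' * m') (hk l' m' hl' hm')
      hst4 hst4 hR4
    rw [show (l' * m' : ℤ) * (s * t) = s * t * l' * m' by ring] at s2
    rw [s1, second_deriv_comm φ n₀ (s * t) (s * t * l' * m'), s2, ← mul_zsmul]
  have C1 := cross l₁ m₁ l₂ m₂ hl₁ hm₁ hl₂ hm₂
  have C2 := cross l₂ m₁ l₁ m₂ hl₂ hm₁ hl₁ hm₂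
  have hK1 : l₁ * m₁ * (l₂ * m₂) = l₁ * l₂ * m₁ * m₂ := by ring
  have hK2 : l₂ * m₁ * (l₁ * m₂) = l₁ * l₂ * m₁ * m₂ := by ring
  rw [hK1] at C1
  rw [hK2] at C2
  rw [T00, T10, T20, T12, X10, X20, X12, C1, C2,
    show 2 * l₁ * l₂ * m₁ * m₂ = l₁ * l₂ * m₁ * m₂ + l₁ * l₂ * m₁ * m₂ by ring, add_zsmul]
  abel

end Summit.Parity.GeneralizedHardyLittlewood.GreenTaoLevelTwoMNTwoQuarticStructure
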